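import Summits.HodgeConjecture.HodgeConjecture.Theorems.K2E1bU21HighestWeightSpaces   -- ★ αᵤ-1b (K2-defs1 (g3)): `wtSpace`, `hwSpace`, `labelN∕M∕E`, `eq_of_labels_eq` (+ ★ αᵤ-1 `K2E1bU21WeightSpaces`)
import Summits.HodgeConjecture.HodgeConjecture.Theorems.K2E1bU21KTypeStrings          -- ★ αᵤ-2a p857192 (K2E4-p11 (g2)): `exists_string_length`
import Summits.HodgeConjecture.HodgeConjecture.Theorems.K2E1bU21PActionNormalForm     -- ★ αᵤ-3 p857269 (K2E4-p10 (g3)): `pPlus_normalForm`, `pMinus_normalForm`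
import Literature.NumberTheory.Automorphic.GKModulesAdCompatOfWeakDeriv                -- ★ `IsGKModule.apply_mem_of_K_stable_of_hasWeakDeriv`
import HarnessLib

/-!
# K2 ∕ E1b · 8b-αᵤ road FILE 4a «THE NORMAL-FORM FAMILY» (first half of row αᵤ-4, O7+O8 of the 8b-α census): one highest-weight vector per
# `K`-type at central label `e`, and GLOBAL coefficient functions `A B C D : ℤ → ℤ → ℂ` in Kovačević's normal form

HCML Track B «K2-LIT», cell `hodgecm-mathlib`, crux H413 = stmt-HodgeConjecture-24833 (supports-only helper; closes nothing by itself).  Socket 8b-αᵤ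
`sig_K2E1bModelOfRecordCohUnitary` (U8d ED. 5b); DEAL (D-αᵤ4) K2E1b-plan (g4) → K2E4-p10 (g3) 2026-09-04T04:13:05Z; MEMO
`K2/K2E1b-plan/g4/MEMO-alpha_u-files-3-5.K2E1b-plan-g4.md` §2.  THEOREMS ONLY (the family is an `∃`; no `def`, no `sorry`, no instance declaration, no notation).
The second half (`Theorems/K2E1bU21DatumRelations.lean :: exists_datum`) reads Kovačević's relations (b20)–(b45) off this family and builds the ★ `SU21Datum`.

## The statement (`exists_normalForm_family`)

For `(𝔤, K)`-module data `(ρK, ρ𝔤)` of `U(2,1)` on `V` (★ `IsGKModule`), a central label `e : ℤ`, and MULTIPLICITY ONE in the form «every `𝔨`-highest line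
★ `hwSpace ρ𝔤 w` is spanned by one vector» (`hmult`; fed by ★ αᵤ-2b `finrank_intertwiningMap_le_one_of_isCohUnitaryIrrep` + admissibility in file 5), there are
`u : ℤ → ℤ → V` and `A B C D : ℤ → ℤ → ℂ` with:
(i) `u n m ≠ 0 →` `u n m ∈ hwSpace w` for a (the) weight `w` with labels `(n, m, e)` (★ `labelN labelM labelE`);
(ii) every `y ∈ hwSpace w` with `labelE w = e` is a multiple of `u (labelN w) (labelM w)` (every `K`-type at central label `e` is hit);
(iii) the STRING: `u n m ≠ 0 → 1 ≤ n`, `f^n (u n m) = 0`, `f^k (u n m) ≠ 0` for `k < n` (★ `exists_string_length` in the `K`-span, finite-dimensional by ★ `kFinite`,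
`f`-stable by ★ `apply_mem_of_K_stable_of_hasWeakDeriv` + ★ `u21f_apply_mem`);
(iv) VANISHING CONVENTIONS: `u n m = 0 → A n m = B n m = C n m = D n m = 0`, and a coefficient INTO an absent `K`-type is `0`
(`u (n+1) (m+3) = 0 → A n m = 0`, `u (n−1) (m+3) = 0 → C n m = 0`, `u (n+1) (m−3) = 0 → B n m = 0`, `u (n−1) (m−3) = 0 → D n m = 0`);
(v) KOVAČEVIĆ'S NORMAL FORM (T1)–(T4) for all `n m k` (★ αᵤ-3 `pPlus_normalForm`, `pMinus_normalForm`, token-parallel to ★ `Xab_vec Xb_vec Yb_vec Yab_vec` with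
`vec n m (k+1) ↔ (−f)^k (u n m)`).

Sources: [Kovacevic2021] §3 Def. 1, Thm. 1; [KnappVogan1995] §IV.1, Prop. 1.18; [BorelWallach2000] II §4.1.
HONEST LABEL: a helper of the 8b-αᵤ road (file 4a of 5); it closes nothing by itself; HC_CM is proved only modulo the 7 printed citations (2 remaining named
inputs: hLiu418 = stmt-HodgeConjecture-24832, h413 = stmt-HodgeConjecture-24833) until rung 0 closes.
-/

-- Mathlib idiom (as in ★ `U21RootMonomials`, ★ αᵤ-1∕1b∕2a∕3): the commutator bracket on `Module.End ℂ V` and on matrices, needed to MENTION `ρ𝔤`.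
attribute [local instance 100] LieRing.ofAssociativeRing

set_option autoImplicit false
set_option linter.dupNamespace false

noncomputable section

namespace Summit.HodgeConjecture.HodgeConjecture.Cruxes.H413.K2E1bU21NormalFormFamily

open Literature.RepresentationTheory Literature.RepresentationTheory.KonnoKonno2007
open Literature.NumberTheory.Automorphic
open Summit.HodgeConjecture.HodgeConjecture.Cruxes.H413.F0P3bLocalAPacketsDefs
open Summit.HodgeConjecture.HodgeConjecture.Cruxes.H413.K2E1bU21Weights
open Summit.HodgeConjecture.HodgeConjecture.Cruxes.H413.K2E1bU21KTypeStrings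
open Summit.HodgeConjecture.HodgeConjecture.Cruxes.H413.K2E1bU21PActionNormalForm

variable {V : Type*} [AddCommGroup V] [Module ℂ V]
  {ρK : Representation ℂ G21.maximalCompact V} (ρ𝔤 : G21.lie →ₗ⁅ℝ⁆ Module.End ℂ V)

/-! ## §1 The string of a highest-weight vector of a `(𝔤, K)`-module terminates at `n = labelN w ≥ 1` -/

/-- **THE STRING OF A `𝔨`-HIGHEST VECTOR**: for `0 ≠ v ∈ hwSpace w` in a `(𝔤, K)`-module of `U(2,1)`, `n := labelN w ≥ 1`, `f^n v = 0` and `f^k v ≠ 0` for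
`k < n` — ★ `exists_string_length` inside the `K`-span of `v` (finite-dimensional by ★ `kFinite`; `K`-stable, hence `𝔨`-stable by ★
`apply_mem_of_K_stable_of_hasWeakDeriv`, hence `f`-stable by ★ `u21f_apply_mem`), the weight `h v = (labelN w − 1) v` (★ `u21h_apply_of_mem_wtSpace'`) fixing `n`.
[cite: Kovacevic2021, §3 Def. 1] [cite: KnappVogan1995, §IV.1, Prop. 1.18] -/
theorem string_of_mem_hwSpace (hGK : IsGKModule G21 ρK ρ𝔤) {w : Fin 2 ⊕ Fin 1 → ℤ} {v : V} (hv : v ∈ hwSpace ρ𝔤 w) (hv0 : v ≠ 0) :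
    1 ≤ labelN w ∧ (u21f ρ𝔤 ^ (labelN w).toNat) v = 0 ∧ ∀ k < (labelN w).toNat, (u21f ρ𝔤 ^ k) v ≠ 0 := by
  set U : Submodule ℂ V := Submodule.span ℂ (Set.range fun k : G21.maximalCompact => ρK k v) with hU
  haveI : FiniteDimensional ℂ U := hGK.kFinite v
  have hUK : ∀ (k : G21.maximalCompact), ∀ u ∈ U, ρK k u ∈ U := by
    intro k u hu
    refine Submodule.span_induction (p := fun u _ => ρK k u ∈ U) ?_ ?_ ?_ ?_ hu
    · rintro _ ⟨k', rfl⟩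
      refine Submodule.subset_span ⟨k * k', ?_⟩
      simp only [map_mul, Module.End.mul_apply]
    · simp only [map_zero, Submodule.zero_mem]
    · intro x y _ _ hx hy
      simpa only [map_add] using Submodule.add_mem _ hx hy
    · intro c x _ hx
      simpa only [map_smul] using Submodule.smul_mem _ c hx
  have hU𝔨 : ∀ Y ∈ G21.kInLie, ∀ u ∈ U, ρ𝔤 Y u ∈ U := by
    intro Y hY u hu
    have hYc := (RealMatrixGroup.mem_kInLie_iff G21 Y).1 hY
    have hXY : LieSubalgebra.inclusion G21.compactLie_le_lie ⟨(Y : Matrix (Fin 2 ⊕ Fin 1) (Fin 2 ⊕ Fin 1) ℂ), hYc⟩ = Y := Subtype.ext rfl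
    rw [← hXY]
    exact IsGKModule.apply_mem_of_K_stable_of_hasWeakDeriv hGK.hasWeakDeriv _ hUK hu
  have hUf : ∀ u ∈ U, u21f ρ𝔤 u ∈ U := fun u hu => u21f_apply_mem ρ𝔤 hU𝔨 hu
  have hvU : v ∈ U := Submodule.subset_span ⟨1, by simp only [map_one, Module.End.one_apply]⟩
  obtain ⟨hvw, hve⟩ := (mem_hwSpace_iff ρ𝔤 w v).1 hv
  obtain ⟨n, hn0, hμ, hfn, hfk⟩ := exists_string_length ρ𝔤 hUf hvU hv0 (u21h_apply_of_mem_wtSpace' ρ𝔤 hvw) hve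
  have hN : labelN w = n := by
    have h1 : ((labelN w - 1 : ℤ) : ℂ) = ((n : ℤ) : ℂ) - 1 := by rw [hμ]; norm_cast
    have h2 : (labelN w - 1 : ℤ) = (n : ℤ) - 1 := by exact_mod_cast h1
    omega
  rw [hN, Int.toNat_natCast]
  exact ⟨by exact_mod_cast hn0, hfn, hfk⟩

/-! ## §2 Labels of the four shifted weights -/

/-- Labels of `w + δ₀ − δ₂` (the `K`-type `(n+1, m+3)` reached by `X_{α+β}`). [cite: Kovacevic2021, §3 Thm 1] -/
theorem labels_shift_pp (w : Fin 2 ⊕ Fin 1 → ℤ) :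
    labelN (w + Pi.single (Sum.inl 0) 1 - Pi.single (Sum.inr 0) 1) = labelN w + 1 ∧
      labelM (w + Pi.single (Sum.inl 0) 1 - Pi.single (Sum.inr 0) 1) = labelM w + 3 ∧
      labelE (w + Pi.single (Sum.inl 0) 1 - Pi.single (Sum.inr 0) 1) = labelE w := by
  simp [labelN, labelM, labelE]; ring_nf; trivial

/-- Labels of `w + δ₁ − δ₂` (the `K`-type `(n−1, m+3)` reached by `X_β`). [cite: Kovacevic2021, §3 Thm 1] -/
theorem labels_shift_mp (w : Fin 2 ⊕ Fin 1 → ℤ) :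
    labelN (w + Pi.single (Sum.inl 1) 1 - Pi.single (Sum.inr 0) 1) = labelN w - 1 ∧
      labelM (w + Pi.single (Sum.inl 1) 1 - Pi.single (Sum.inr 0) 1) = labelM w + 3 ∧
      labelE (w + Pi.single (Sum.inl 1) 1 - Pi.single (Sum.inr 0) 1) = labelE w := by
  simp [labelN, labelM, labelE]; ring_nf; trivial

/-- Labels of `w + δ₂ − δ₁` (the `K`-type `(n+1, m−3)` reached by `Y_β`). [cite: Kovacevic2021, §3 Thm 1] -/
theorem labels_shift_pm (w : Fin 2 ⊕ Fin 1 → ℤ) :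
    labelN (w + Pi.single (Sum.inr 0) 1 - Pi.single (Sum.inl 1) 1) = labelN w + 1 ∧
      labelM (w + Pi.single (Sum.inr 0) 1 - Pi.single (Sum.inl 1) 1) = labelM w - 3 ∧
      labelE (w + Pi.single (Sum.inr 0) 1 - Pi.single (Sum.inl 1) 1) = labelE w := by
  simp [labelN, labelM, labelE]; ring_nf; trivial

/-- Labels of `w + δ₂ − δ₀` (the `K`-type `(n−1, m−3)` reached by `Y_{α+β}`). [cite: Kovacevic2021, §3 Thm 1] -/
theorem labels_shift_mm (w : Fin 2 ⊕ Fin 1 → ℤ) :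
    labelN (w + Pi.single (Sum.inr 0) 1 - Pi.single (Sum.inl 0) 1) = labelN w - 1 ∧
      labelM (w + Pi.single (Sum.inr 0) 1 - Pi.single (Sum.inl 0) 1) = labelM w - 3 ∧
      labelE (w + Pi.single (Sum.inr 0) 1 - Pi.single (Sum.inl 0) 1) = labelE w := by
  simp [labelN, labelM, labelE]; ring_nf; trivial

/-! ## §3 The normal-form family -/

/-- **THE NORMAL-FORM FAMILY** (see the module docstring for the five clauses).  Construction: choose a spanning vector `g w` of every line `hwSpace w`
(`hmult`), put `u n m := g w` for the weight `w` with labels `(n, m, e)` (unique, ★ `eq_of_labels_eq`; `u n m := 0` if there is none), and at each `K`-type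
apply ★ `pPlus_normalForm` ∕ ★ `pMinus_normalForm` with `v := u n m`, `v₊ := u (n±1) (m±3)` (the uniqueness hypotheses there are clause (ii) at the shifted
weights, §2), normalising a coefficient to `0` whenever its target vector is `0`. [cite: Kovacevic2021, §3 Def. 1, Thm. 1] [cite: KnappVogan1995, §IV.1] -/
theorem exists_normalForm_family (hGK : IsGKModule G21 ρK ρ𝔤) (e : ℤ)
    (hmult : ∀ w : Fin 2 ⊕ Fin 1 → ℤ, ∃ g : V, g ∈ hwSpace ρ𝔤 w ∧ ∀ y ∈ hwSpace ρ𝔤 w, ∃ c : ℂ, y = c • g) :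
    ∃ (u : ℤ → ℤ → V) (A B C D : ℤ → ℤ → ℂ),
      (∀ n m : ℤ, u n m ≠ 0 → ∃ w, labelN w = n ∧ labelM w = m ∧ labelE w = e ∧ u n m ∈ hwSpace ρ𝔤 w) ∧
      (∀ (w : Fin 2 ⊕ Fin 1 → ℤ) (y : V), labelE w = e → y ∈ hwSpace ρ𝔤 w → ∃ c : ℂ, y = c • u (labelN w) (labelM w)) ∧
      (∀ n m : ℤ, u n m ≠ 0 → 1 ≤ n ∧ (u21f ρ𝔤 ^ n.toNat) (u n m) = 0 ∧ ∀ k < n.toNat, (u21f ρ𝔤 ^ k) (u n m) ≠ 0) ∧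
      (∀ n m : ℤ, (u n m = 0 → A n m = 0 ∧ B n m = 0 ∧ C n m = 0 ∧ D n m = 0) ∧
        (u (n + 1) (m + 3) = 0 → A n m = 0) ∧ (u (n - 1) (m + 3) = 0 → C n m = 0) ∧
        (u (n + 1) (m - 3) = 0 → B n m = 0) ∧ (u (n - 1) (m - 3) = 0 → D n m = 0)) ∧
      (∀ (n m : ℤ) (k : ℕ),
        u21E ρ𝔤 0 (((-u21f ρ𝔤) ^ k) (u n m)) =
            (((n : ℂ) - k) * A n m) • ((-u21f ρ𝔤) ^ k) (u (n + 1) (m + 3)) + ((k : ℂ) * C n m) • ((-u21f ρ𝔤) ^ (k - 1)) (u (n - 1) (m + 3)) ∧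
        u21E ρ𝔤 1 (((-u21f ρ𝔤) ^ k) (u n m)) =
            (-A n m) • ((-u21f ρ𝔤) ^ (k + 1)) (u (n + 1) (m + 3)) + C n m • ((-u21f ρ𝔤) ^ k) (u (n - 1) (m + 3)) ∧
        u21F ρ𝔤 1 (((-u21f ρ𝔤) ^ k) (u n m)) =
            (((n : ℂ) - k) * B n m) • ((-u21f ρ𝔤) ^ k) (u (n + 1) (m - 3)) - ((k : ℂ) * D n m) • ((-u21f ρ𝔤) ^ (k - 1)) (u (n - 1) (m - 3)) ∧
        u21F ρ𝔤 0 (((-u21f ρ𝔤) ^ k) (u n m)) =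
            B n m • ((-u21f ρ𝔤) ^ (k + 1)) (u (n + 1) (m - 3)) + D n m • ((-u21f ρ𝔤) ^ k) (u (n - 1) (m - 3))) := by
  classical
  choose g hg hgu using hmult
  -- the family: `u n m := g w` for the weight `w` with labels `(n, m, e)`, `0` if there is none
  let u : ℤ → ℤ → V := fun n m => if h : ∃ w, labelN w = n ∧ labelM w = m ∧ labelE w = e then g h.choose else 0
  have hu_lab : ∀ w, labelE w = e → u (labelN w) (labelM w) = g w := by
    intro w hwe
    have hex : ∃ w', labelN w' = labelN w ∧ labelM w' = labelM w ∧ labelE w' = e := ⟨w, rfl, rfl, hwe⟩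
    simp only [u, dif_pos hex]
    obtain ⟨h1, h2, h3⟩ := hex.choose_spec
    rw [eq_of_labels_eq h1 h2 (h3.trans hwe.symm)]
  have hi : ∀ n m : ℤ, u n m ≠ 0 → ∃ w, labelN w = n ∧ labelM w = m ∧ labelE w = e ∧ u n m ∈ hwSpace ρ𝔤 w := by
    intro n m hne
    by_cases hex : ∃ w, labelN w = n ∧ labelM w = m ∧ labelE w = e
    · obtain ⟨h1, h2, h3⟩ := hex.choose_spec
      refine ⟨hex.choose, h1, h2, h3, ?_⟩
      simp only [u, dif_pos hex]
      exact hg _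
    · exact absurd (by simp only [u, dif_neg hex]) hne
  have hii : ∀ (w : Fin 2 ⊕ Fin 1 → ℤ) (y : V), labelE w = e → y ∈ hwSpace ρ𝔤 w → ∃ c : ℂ, y = c • u (labelN w) (labelM w) := by
    intro w y hwe hy
    rw [hu_lab w hwe]
    exact hgu w y hy
  have hiii : ∀ n m : ℤ, u n m ≠ 0 → 1 ≤ n ∧ (u21f ρ𝔤 ^ n.toNat) (u n m) = 0 ∧ ∀ k < n.toNat, (u21f ρ𝔤 ^ k) (u n m) ≠ 0 := by
    intro n m hne
    obtain ⟨w, h1, -, -, hw⟩ := hi n m hne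
    subst h1
    exact string_of_mem_hwSpace ρ𝔤 hGK hw hne
  have hmem : ∀ w, labelE w = e → u (labelN w) (labelM w) ∈ hwSpace ρ𝔤 w := by
    intro w hwe
    rw [hu_lab w hwe]
    exact hg w
  -- weights and primitivity of `u` at a weight with the right labels, as eigen-equations (the shape of ★ αᵤ-3's hypotheses)
  have hwt : ∀ w, labelE w = e → ∀ i, upqLieC ρ𝔤 (Matrix.single i i (1 : ℂ)) (u (labelN w) (labelM w)) = ((w i : ℤ) : ℂ) • u (labelN w) (labelM w) :=
    fun w hwe => (mem_wtSpace_iff ρ𝔤 w _).1 ((mem_hwSpace_iff ρ𝔤 w _).1 (hmem w hwe)).1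
  have hprim : ∀ w, labelE w = e → u21e ρ𝔤 (u (labelN w) (labelM w)) = 0 :=
    fun w hwe => ((mem_hwSpace_iff ρ𝔤 w _).1 (hmem w hwe)).2
  have huniq : ∀ w, labelE w = e → ∀ y : V, (∀ i, upqLieC ρ𝔤 (Matrix.single i i (1 : ℂ)) y = ((w i : ℤ) : ℂ) • y) → u21e ρ𝔤 y = 0 →
      ∃ c : ℂ, y = c • u (labelN w) (labelM w) :=
    fun w hwe y hy hey => hii w y hwe ((mem_hwSpace_iff ρ𝔤 w y).2 ⟨(mem_wtSpace_iff ρ𝔤 w y).2 hy, hey⟩)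
  -- the coefficients, one `K`-type at a time
  have key : ∀ n m : ℤ, ∃ A B C D : ℂ,
      ((u n m = 0 → A = 0 ∧ B = 0 ∧ C = 0 ∧ D = 0) ∧ (u (n + 1) (m + 3) = 0 → A = 0) ∧ (u (n - 1) (m + 3) = 0 → C = 0) ∧
        (u (n + 1) (m - 3) = 0 → B = 0) ∧ (u (n - 1) (m - 3) = 0 → D = 0)) ∧
      ∀ k : ℕ,
        u21E ρ𝔤 0 (((-u21f ρ𝔤) ^ k) (u n m)) =
            (((n : ℂ) - k) * A) • ((-u21f ρ𝔤) ^ k) (u (n + 1) (m + 3)) + ((k : ℂ) * C) • ((-u21f ρ𝔤) ^ (k - 1)) (u (n - 1) (m + 3)) ∧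
        u21E ρ𝔤 1 (((-u21f ρ𝔤) ^ k) (u n m)) =
            (-A) • ((-u21f ρ𝔤) ^ (k + 1)) (u (n + 1) (m + 3)) + C • ((-u21f ρ𝔤) ^ k) (u (n - 1) (m + 3)) ∧
        u21F ρ𝔤 1 (((-u21f ρ𝔤) ^ k) (u n m)) =
            (((n : ℂ) - k) * B) • ((-u21f ρ𝔤) ^ k) (u (n + 1) (m - 3)) - ((k : ℂ) * D) • ((-u21f ρ𝔤) ^ (k - 1)) (u (n - 1) (m - 3)) ∧
        u21F ρ𝔤 0 (((-u21f ρ𝔤) ^ k) (u n m)) =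
            B • ((-u21f ρ𝔤) ^ (k + 1)) (u (n + 1) (m - 3)) + D • ((-u21f ρ𝔤) ^ k) (u (n - 1) (m - 3)) := by
    intro n m
    by_cases hne : u n m = 0
    · refine ⟨0, 0, 0, 0, ⟨fun _ => ⟨rfl, rfl, rfl, rfl⟩, fun _ => rfl, fun _ => rfl, fun _ => rfl, fun _ => rfl⟩, fun k => ?_⟩
      simp only [hne, map_zero, mul_zero, zero_smul, neg_zero, add_zero, sub_zero, and_self]
    obtain ⟨w, h1, h2, h3, hw⟩ := hi n m hne
    obtain ⟨hn1, -, -⟩ := hiii n m hne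
    obtain ⟨N, rfl⟩ : ∃ N : ℕ, n = N := ⟨n.toNat, (Int.toNat_of_nonneg (by omega)).symm⟩
    have hN1 : 1 ≤ N := by exact_mod_cast hn1
    have hNw : (N : ℤ) = w (Sum.inl 0) - w (Sum.inl 1) + 1 := by rw [← h1]; rfl
    -- the vector and its four neighbours, addressed by their weights
    have hv : ∀ i, upqLieC ρ𝔤 (Matrix.single i i (1 : ℂ)) (u N m) = ((w i : ℤ) : ℂ) • u N m := by
      have := hwt w h3; rwa [h1, h2] at this
    have hev : u21e ρ𝔤 (u N m) = 0 := by have := hprim w h3; rwa [h1, h2] at this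
    obtain ⟨hppN, hppM, hppE⟩ := labels_shift_pp w
    obtain ⟨hmpN, hmpM, hmpE⟩ := labels_shift_mp w
    obtain ⟨hpmN, hpmM, hpmE⟩ := labels_shift_pm w
    obtain ⟨hmmN, hmmM, hmmE⟩ := labels_shift_mm w
    rw [h1] at hppN hmpN hpmN hmmN
    rw [h2] at hppM hmpM hpmM hmmM
    rw [h3] at hppE hmpE hpmE hmmE
    -- `𝔭⁺`
    have hvp := hwt _ hppE
    have hevp := hprim _ hppE
    have hup := huniq _ hppE
    have hum := huniq _ hmpE
    rw [hppN, hppM] at hvp hevp hup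
    rw [hmpN, hmpM] at hum
    obtain ⟨A, C, hAC⟩ := pPlus_normalForm ρ𝔤 hNw hN1 hv hev hvp hevp hup hum
    -- `𝔭⁻`
    have hvp' := hwt _ hpmE
    have hevp' := hprim _ hpmE
    have hup' := huniq _ hpmE
    have hum' := huniq _ hmmE
    rw [hpmN, hpmM] at hvp' hevp' hup'
    rw [hmmN, hmmM] at hum'
    obtain ⟨B, D, hBD⟩ := pMinus_normalForm ρ𝔤 hNw hN1 hv hev hvp' hevp' hup' hum'
    -- normalise: a coefficient into an absent `K`-type is `0`
    refine ⟨if u ((N : ℤ) + 1) (m + 3) = 0 then 0 else A, if u ((N : ℤ) + 1) (m - 3) = 0 then 0 else B,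
      if u ((N : ℤ) - 1) (m + 3) = 0 then 0 else C, if u ((N : ℤ) - 1) (m - 3) = 0 then 0 else D,
      ⟨fun h => absurd h hne, fun h => if_pos h, fun h => if_pos h, fun h => if_pos h, fun h => if_pos h⟩, fun k => ?_⟩
    obtain ⟨h1k, h2k⟩ := hAC k
    obtain ⟨h3k, h4k⟩ := hBD k
    push_cast at h1k h2k h3k h4k ⊢
    refine ⟨?_, ?_, ?_, ?_⟩
    · rw [h1k]
      by_cases ha : u ((N : ℤ) + 1) (m + 3) = 0 <;> by_cases hc : u ((N : ℤ) - 1) (m + 3) = 0 <;>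
        simp only [ha, hc, reduceIte, map_zero, smul_zero, mul_zero, add_zero, zero_add]
    · rw [h2k]
      by_cases ha : u ((N : ℤ) + 1) (m + 3) = 0 <;> by_cases hc : u ((N : ℤ) - 1) (m + 3) = 0 <;>
        simp only [ha, hc, reduceIte, map_zero, smul_zero, add_zero, zero_add, neg_zero]
    · rw [h3k]
      by_cases hb : u ((N : ℤ) + 1) (m - 3) = 0 <;> by_cases hd : u ((N : ℤ) - 1) (m - 3) = 0 <;>
        simp only [hb, hd, reduceIte, map_zero, smul_zero, mul_zero, sub_zero, zero_sub]
    · rw [h4k]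
      by_cases hb : u ((N : ℤ) + 1) (m - 3) = 0 <;> by_cases hd : u ((N : ℤ) - 1) (m - 3) = 0 <;>
        simp only [hb, hd, reduceIte, map_zero, smul_zero, add_zero, zero_add]
  choose A B C D hkey using key
  exact ⟨u, A, B, C, D, hi, hii, hiii, fun n m => (hkey n m).1, fun n m k => (hkey n m).2 k⟩

end Summit.HodgeConjecture.HodgeConjecture.Cruxes.H413.K2E1bU21NormalFormFamily

end
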